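import Summits.QuantumFields.YangMills.Theses.BoundedSkewnessRunning
import Summits.QuantumFields.YangMills.Theorems.BoundedSkewnessRunningOffDiagonalReductionDensity
import Literature.MathematicalPhysics.QuantumLattice.SchwartzKernelTheorem
import Literature.MathematicalPhysics.QuantumFieldTheory.OSSkeletonExplicitBounds
import HarnessLib

/-!
# Route `BoundedSkewnessRunning` (YM refutation route): the support item `OffDiagonalReduction`
# (stmt-QuantumFields-19900) — OFF-DIAGONAL REDUCTION OF `IsNonGaussian`

For any OS data `T` and species `s`: if the seven-term connected three-point combination of `T.schwinger`
vanishes on all tensors of every compactly supported, pairwise-disjoint REAL Schwartz triple, then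
`¬ T.IsNonGaussian s` — i.e. it vanishes on every off-diagonal tensor `f ⊗ g ⊗ h ∈ ⁰𝒮` of COMPLEX Schwartz
functions.  Proof:
* the connected combination `κ₃(g₀,g₁,g₂) = S₃(g₀⊗g₁⊗g₂) − Σ S₁(gᵢ)S₂(gⱼ⊗gₖ) + 2 S₁S₁S₁` is a jointly continuous
  complex TRILINEAR form on `𝓢(ℝ⁴,ℂ)³` (`exists_kappa3_multilinear`: multilinearity of the tensor product, slot by
  slot; continuity from the tree's `continuous_tensorFin`);
* the tree's Schwartz kernel theorem for multilinear forms (`existsUnique_schwartzKernel`, Reed–Simon I Thm V.12)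
  gives a continuous linear functional `K` on `𝓢((ℝ⁴)³, ℂ)` with `K(g₀⊗g₁⊗g₂) = κ₃(g₀,g₁,g₂)`;
* by hypothesis `K` kills the real product tensors with compactly supported pairwise disjoint factors (their
  sub-tensors are off-diagonal by the support criterion), hence, by the density of the sibling module
  (`eq_zero_offDiagonal_of_forall_disjointTensor`: those tensors span `⁰𝒮` densely), `K` kills `⁰𝒮`;
* a non-Gaussianity witness `(f, g, h)` has `f⊗g⊗h ∈ ⁰𝒮`, so its `κ₃ = K(f⊗g⊗h) = 0` — contradiction.
No summit, leg or crux statement is proved; the route's cruxes (K1 UV extinction, K2 non-generation) are open.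

References: Reed–Simon I, Thm V.12 (kernel theorem); Osterwalder–Schrader 1973 §2 (`⁰𝒮`); Glimm–Jaffe §6.1
(truncated functions).
-/

noncomputable section

open scoped SchwartzMap Topology
open Filter Set Function
open Literature.MathematicalPhysics.QuantumLattice Literature.MathematicalPhysics.AQFT
  Literature.MathematicalPhysics.QuantumFieldTheory

namespace Summit.QuantumFields.YangMills.Theorems.OffDiagonalReduction

/-! ## The tensor product is linear in each slot (vector-literal forms) -/

section Tensor

variable {E : Type*} [NormedAddCommGroup E] [NormedSpace ℝ E] {m : ℕ}

/-- Head of a cons: `(v ⊗ t)(x) = v(x₀) · (⊗t)(x ∘ succ)`. [folklore] -/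
theorem tensorFin_cons_apply (v : 𝓢(E, ℂ)) (t : Fin m → 𝓢(E, ℂ)) (x : Fin (m + 1) → E) :
    SchwartzMap.tensorFin (m + 1) (Matrix.vecCons v t) x =
      v (x 0) * SchwartzMap.tensorFin m t (fun i => x i.succ) := by
  simp only [SchwartzMap.tensorFin_apply, Fin.prod_univ_succ, Matrix.cons_val_zero, Matrix.cons_val_succ]

/-- Additivity in slot `0`. [folklore] -/
theorem tensorFin_cons_add (a b : 𝓢(E, ℂ)) (t : Fin m → 𝓢(E, ℂ)) :
    SchwartzMap.tensorFin (m + 1) (Matrix.vecCons (a + b) t) =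
      SchwartzMap.tensorFin (m + 1) (Matrix.vecCons a t) + SchwartzMap.tensorFin (m + 1) (Matrix.vecCons b t) := by
  ext x; simp only [tensorFin_cons_apply, add_apply, add_mul]

/-- Homogeneity in slot `0`. [folklore] -/
theorem tensorFin_cons_smul (c : ℂ) (a : 𝓢(E, ℂ)) (t : Fin m → 𝓢(E, ℂ)) :
    SchwartzMap.tensorFin (m + 1) (Matrix.vecCons (c • a) t) =
      c • SchwartzMap.tensorFin (m + 1) (Matrix.vecCons a t) := by
  ext x; simp only [tensorFin_cons_apply, smul_apply, smul_eq_mul, mul_assoc]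

/-- Additivity in slot `1`. [folklore] -/
theorem tensorFin_cons_cons_add (v a b : 𝓢(E, ℂ)) (t : Fin m → 𝓢(E, ℂ)) :
    SchwartzMap.tensorFin (m + 2) (Matrix.vecCons v (Matrix.vecCons (a + b) t)) =
      SchwartzMap.tensorFin (m + 2) (Matrix.vecCons v (Matrix.vecCons a t)) +
        SchwartzMap.tensorFin (m + 2) (Matrix.vecCons v (Matrix.vecCons b t)) := by
  ext x; simp only [tensorFin_cons_apply, add_apply]; ring

/-- Homogeneity in slot `1`. [folklore] -/
theorem tensorFin_cons_cons_smul (c : ℂ) (v a : 𝓢(E, ℂ)) (t : Fin m → 𝓢(E, ℂ)) :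
    SchwartzMap.tensorFin (m + 2) (Matrix.vecCons v (Matrix.vecCons (c • a) t)) =
      c • SchwartzMap.tensorFin (m + 2) (Matrix.vecCons v (Matrix.vecCons a t)) := by
  ext x; simp only [tensorFin_cons_apply, smul_apply, smul_eq_mul]; ring

/-- Additivity in slot `2`. [folklore] -/
theorem tensorFin_cons_cons_cons_add (v w a b : 𝓢(E, ℂ)) (t : Fin m → 𝓢(E, ℂ)) :
    SchwartzMap.tensorFin (m + 3) (Matrix.vecCons v (Matrix.vecCons w (Matrix.vecCons (a + b) t))) =
      SchwartzMap.tensorFin (m + 3) (Matrix.vecCons v (Matrix.vecCons w (Matrix.vecCons a t))) +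
        SchwartzMap.tensorFin (m + 3) (Matrix.vecCons v (Matrix.vecCons w (Matrix.vecCons b t))) := by
  ext x; simp only [tensorFin_cons_apply, add_apply]; ring

/-- Homogeneity in slot `2`. [folklore] -/
theorem tensorFin_cons_cons_cons_smul (c : ℂ) (v w a : 𝓢(E, ℂ)) (t : Fin m → 𝓢(E, ℂ)) :
    SchwartzMap.tensorFin (m + 3) (Matrix.vecCons v (Matrix.vecCons w (Matrix.vecCons (c • a) t))) =
      c • SchwartzMap.tensorFin (m + 3) (Matrix.vecCons v (Matrix.vecCons w (Matrix.vecCons a t))) := by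
  ext x; simp only [tensorFin_cons_apply, smul_apply, smul_eq_mul]; ring

/-- `g ↦ (g₀, g₁, g₂)` re-assembled as a vector literal is continuous. [folklore] -/
theorem continuous_vec3 {X : Type*} [TopologicalSpace X] :
    Continuous fun g : Fin 3 → X => (![g 0, g 1, g 2] : Fin 3 → X) := by
  refine continuous_pi fun i => ?_
  fin_cases i
  · simpa using continuous_apply (0 : Fin 3)
  · simpa using continuous_apply (1 : Fin 3)
  · simpa using continuous_apply (2 : Fin 3)

/-- `g ↦ (gᵢ, gⱼ)` is continuous. [folklore] -/
theorem continuous_vec2 {X : Type*} [TopologicalSpace X] (i j : Fin 3) :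
    Continuous fun g : Fin 3 → X => (![g i, g j] : Fin 2 → X) := by
  refine continuous_pi fun k => ?_
  fin_cases k
  · simpa using continuous_apply i
  · simpa using continuous_apply j

/-- `g ↦ (gᵢ)` is continuous. [folklore] -/
theorem continuous_vec1 {X : Type*} [TopologicalSpace X] (i : Fin 3) :
    Continuous fun g : Fin 3 → X => (![g i] : Fin 1 → X) := by
  refine continuous_pi fun k => ?_
  fin_cases k
  simpa using continuous_apply i

end Tensor

/-! ## The connected three-point combination as a continuous trilinear form, and its kernel -/

section Kappa

variable {ι : Type} (T : OSData ι 4) (s : ι)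

/-- **`κ₃` is a jointly continuous complex trilinear form.**  There is a continuous `ℂ`-trilinear form `M` on
`𝓢(ℝ⁴, ℂ)³` with `M(g) = S₃(g₀⊗g₁⊗g₂) − S₁(g₀)S₂(g₁⊗g₂) − S₁(g₁)S₂(g₀⊗g₂) − S₁(g₂)S₂(g₀⊗g₁) + 2S₁(g₀)S₁(g₁)S₁(g₂)`
(`Sₙ = T.schwinger n (s,…,s)` on the canonical tensors `tensorFin`). [cite: GlimmJaffe1987, §6.1 (truncated functions)] -/
theorem exists_kappa3_multilinear :
    ∃ M : MultilinearMap ℂ (fun _ : Fin 3 => 𝓢(EuclideanSpace ℝ (Fin 4), ℂ)) ℂ, Continuous M ∧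
      ∀ g : Fin 3 → 𝓢(EuclideanSpace ℝ (Fin 4), ℂ), M g =
        T.schwinger 3 (fun _ => s) (SchwartzMap.tensorFin 3 ![g 0, g 1, g 2]) -
          T.schwinger 1 (fun _ => s) (SchwartzMap.tensorFin 1 ![g 0]) *
            T.schwinger 2 (fun _ => s) (SchwartzMap.tensorFin 2 ![g 1, g 2]) -
          T.schwinger 1 (fun _ => s) (SchwartzMap.tensorFin 1 ![g 1]) *
            T.schwinger 2 (fun _ => s) (SchwartzMap.tensorFin 2 ![g 0, g 2]) -
          T.schwinger 1 (fun _ => s) (SchwartzMap.tensorFin 1 ![g 2]) *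
            T.schwinger 2 (fun _ => s) (SchwartzMap.tensorFin 2 ![g 0, g 1]) +
          2 * (T.schwinger 1 (fun _ => s) (SchwartzMap.tensorFin 1 ![g 0]) *
            T.schwinger 1 (fun _ => s) (SchwartzMap.tensorFin 1 ![g 1]) *
            T.schwinger 1 (fun _ => s) (SchwartzMap.tensorFin 1 ![g 2])) := by
  -- index facts, proved with the canonical `DecidableEq (Fin 3)` (the multilinearity fields quantify over an
  -- arbitrary instance, under which `decide` must not be used)
  have h10 : (1 : Fin 3) ≠ 0 := by decide
  have h20 : (2 : Fin 3) ≠ 0 := by decide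
  have h01 : (0 : Fin 3) ≠ 1 := by decide
  have h21 : (2 : Fin 3) ≠ 1 := by decide
  have h02 : (0 : Fin 3) ≠ 2 := by decide
  have h12 : (1 : Fin 3) ≠ 2 := by decide
  refine ⟨⟨fun g =>
        (T.schwinger 3 (fun _ => s) (SchwartzMap.tensorFin 3 ![g 0, g 1, g 2]) -
          T.schwinger 1 (fun _ => s) (SchwartzMap.tensorFin 1 ![g 0]) *
            T.schwinger 2 (fun _ => s) (SchwartzMap.tensorFin 2 ![g 1, g 2]) -
          T.schwinger 1 (fun _ => s) (SchwartzMap.tensorFin 1 ![g 1]) *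
            T.schwinger 2 (fun _ => s) (SchwartzMap.tensorFin 2 ![g 0, g 2]) -
          T.schwinger 1 (fun _ => s) (SchwartzMap.tensorFin 1 ![g 2]) *
            T.schwinger 2 (fun _ => s) (SchwartzMap.tensorFin 2 ![g 0, g 1]) +
          2 * (T.schwinger 1 (fun _ => s) (SchwartzMap.tensorFin 1 ![g 0]) *
            T.schwinger 1 (fun _ => s) (SchwartzMap.tensorFin 1 ![g 1]) *
            T.schwinger 1 (fun _ => s) (SchwartzMap.tensorFin 1 ![g 2]))), ?_, ?_⟩, ?_, fun g => rfl⟩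
  · intro _ g j x y
    fin_cases j <;>
      simp only [Fin.zero_eta, Fin.mk_one, Fin.reduceFinMk, Function.update_self,
        Function.update_of_ne h10, Function.update_of_ne h20, Function.update_of_ne h01,
        Function.update_of_ne h21, Function.update_of_ne h02, Function.update_of_ne h12,
        tensorFin_cons_add, tensorFin_cons_cons_add, tensorFin_cons_cons_cons_add, map_add] <;> ring
  · intro _ g j c x
    fin_cases j <;>
      simp only [Fin.zero_eta, Fin.mk_one, Fin.reduceFinMk, Function.update_self,
        Function.update_of_ne h10, Function.update_of_ne h20, Function.update_of_ne h01,
        Function.update_of_ne h21, Function.update_of_ne h02, Function.update_of_ne h12,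
        tensorFin_cons_smul, tensorFin_cons_cons_smul, tensorFin_cons_cons_cons_smul, map_smul,
        smul_eq_mul] <;> ring
  · -- continuity
    have h3 : Continuous fun g : Fin 3 → 𝓢(EuclideanSpace ℝ (Fin 4), ℂ) =>
        T.schwinger 3 (fun _ => s) (SchwartzMap.tensorFin 3 ![g 0, g 1, g 2]) :=
      (T.schwinger 3 _).continuous.comp ((continuous_tensorFin 3).comp continuous_vec3)
    have h2 : ∀ i j : Fin 3, Continuous fun g : Fin 3 → 𝓢(EuclideanSpace ℝ (Fin 4), ℂ) =>
        T.schwinger 2 (fun _ => s) (SchwartzMap.tensorFin 2 ![g i, g j]) := fun i j =>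
      (T.schwinger 2 _).continuous.comp ((continuous_tensorFin 2).comp (continuous_vec2 i j))
    have h1 : ∀ i : Fin 3, Continuous fun g : Fin 3 → 𝓢(EuclideanSpace ℝ (Fin 4), ℂ) =>
        T.schwinger 1 (fun _ => s) (SchwartzMap.tensorFin 1 ![g i]) := fun i =>
      (T.schwinger 1 _).continuous.comp ((continuous_tensorFin 1).comp (continuous_vec1 i))
    show Continuous fun g : Fin 3 → 𝓢(EuclideanSpace ℝ (Fin 4), ℂ) =>
        T.schwinger 3 (fun _ => s) (SchwartzMap.tensorFin 3 ![g 0, g 1, g 2]) -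
          T.schwinger 1 (fun _ => s) (SchwartzMap.tensorFin 1 ![g 0]) *
            T.schwinger 2 (fun _ => s) (SchwartzMap.tensorFin 2 ![g 1, g 2]) -
          T.schwinger 1 (fun _ => s) (SchwartzMap.tensorFin 1 ![g 1]) *
            T.schwinger 2 (fun _ => s) (SchwartzMap.tensorFin 2 ![g 0, g 2]) -
          T.schwinger 1 (fun _ => s) (SchwartzMap.tensorFin 1 ![g 2]) *
            T.schwinger 2 (fun _ => s) (SchwartzMap.tensorFin 2 ![g 0, g 1]) +
          2 * (T.schwinger 1 (fun _ => s) (SchwartzMap.tensorFin 1 ![g 0]) *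
            T.schwinger 1 (fun _ => s) (SchwartzMap.tensorFin 1 ![g 1]) *
            T.schwinger 1 (fun _ => s) (SchwartzMap.tensorFin 1 ![g 2]))
    exact (((h3.sub ((h1 0).mul (h2 1 2))).sub ((h1 1).mul (h2 0 2))).sub ((h1 2).mul (h2 0 1))).add
      (continuous_const.mul (((h1 0).mul (h1 1)).mul (h1 2)))

/-- **The kernel of `κ₃`**: a continuous linear functional `K` on `𝓢((ℝ⁴)³, ℂ)` with `K(g₀⊗g₁⊗g₂) = κ₃(g₀,g₁,g₂)`
for all complex triples (Schwartz kernel theorem applied to `exists_kappa3_multilinear`).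
[cite: ReedSimonI1980, Thm V.12] -/
theorem exists_kappa3_kernel :
    ∃ K : 𝓢((Fin 3 → EuclideanSpace ℝ (Fin 4)), ℂ) →L[ℂ] ℂ,
      ∀ g : Fin 3 → 𝓢(EuclideanSpace ℝ (Fin 4), ℂ), K (SchwartzMap.tensorFin 3 g) =
        T.schwinger 3 (fun _ => s) (SchwartzMap.tensorFin 3 ![g 0, g 1, g 2]) -
          T.schwinger 1 (fun _ => s) (SchwartzMap.tensorFin 1 ![g 0]) *
            T.schwinger 2 (fun _ => s) (SchwartzMap.tensorFin 2 ![g 1, g 2]) -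
          T.schwinger 1 (fun _ => s) (SchwartzMap.tensorFin 1 ![g 1]) *
            T.schwinger 2 (fun _ => s) (SchwartzMap.tensorFin 2 ![g 0, g 2]) -
          T.schwinger 1 (fun _ => s) (SchwartzMap.tensorFin 1 ![g 2]) *
            T.schwinger 2 (fun _ => s) (SchwartzMap.tensorFin 2 ![g 0, g 1]) +
          2 * (T.schwinger 1 (fun _ => s) (SchwartzMap.tensorFin 1 ![g 0]) *
            T.schwinger 1 (fun _ => s) (SchwartzMap.tensorFin 1 ![g 1]) *
            T.schwinger 1 (fun _ => s) (SchwartzMap.tensorFin 1 ![g 2])) := by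
  obtain ⟨M, hMc, hM⟩ := exists_kappa3_multilinear T s
  obtain ⟨K, hK, -⟩ := existsUnique_schwartzKernel M hMc
  exact ⟨K, fun g => by rw [hK g, hM g]⟩

end Kappa

/-! ## The item -/

/-- A product tensor of real test functions with pairwise disjoint supports along an injective selection of
slots is off-diagonal (support criterion). [folklore] -/
theorem isOffDiagonal_of_disjoint_tensor {n m : ℕ} {u : Fin n → 𝓢(EuclideanSpace ℝ (Fin 4), ℝ)}
    (hd : ∀ i j, i ≠ j → Disjoint (tsupport (u i : EuclideanSpace ℝ (Fin 4) → ℝ))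
      (tsupport (u j : EuclideanSpace ℝ (Fin 4) → ℝ)))
    (e : Fin m → Fin n) (he : Function.Injective e)
    {P : 𝓢((Fin m → EuclideanSpace ℝ (Fin 4)), ℂ)} (hP : IsTensorOf P (fun i => ofRealTest (u (e i)))) :
    IsOffDiagonal P := by
  refine IsOffDiagonal.of_tsupport_subset fun x hx => ?_
  rw [mem_compl_iff, mem_coincidenceLocus]
  rintro ⟨i, j, hij, hxij⟩
  have hxi : x i ∈ tsupport (u (e i) : EuclideanSpace ℝ (Fin 4) → ℝ) :=
    tsupport_comp_subset (g := fun t : ℝ => (t : ℂ)) Complex.ofReal_zero _ (hP.tsupport_subset hx i)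
  have hxj : x j ∈ tsupport (u (e j) : EuclideanSpace ℝ (Fin 4) → ℝ) :=
    tsupport_comp_subset (g := fun t : ℝ => (t : ℂ)) Complex.ofReal_zero _ (hP.tsupport_subset hx j)
  rw [hxij] at hxi
  exact Set.disjoint_left.mp (hd (e i) (e j) (he.ne hij)) hxi hxj

/-- **Item stmt-QuantumFields-19900 `BoundedSkewnessRunning.OffDiagonalReduction` holds**: if the seven-term
connected three-point combination of `T.schwinger` vanishes on all tensors of every compactly supported,
pairwise-disjoint real Schwartz triple, then `¬ T.IsNonGaussian s`. [cite: ReedSimonI1980, Thm V.12]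
[cite: OS1973, §2] [cite: GlimmJaffe1987, §6.1] -/
theorem boundedSkewnessRunning_offDiagonalReduction_proof :
    Summit.QuantumFields.YangMills.Theses.BoundedSkewnessRunning.OffDiagonalReduction := by
  unfold Summit.QuantumFields.YangMills.Theses.BoundedSkewnessRunning.OffDiagonalReduction
  intro ι T s hyp
  rintro ⟨f, g, h, Ffgh, Fgh, Ffh, Ffg, Ff, Fg, Fh, hFfgh, hoff, hFgh, hFfh, hFfg, hFf, hFg, hFh, hne⟩
  dsimp only at hne
  apply hne
  obtain ⟨K, hK⟩ := exists_kappa3_kernel T s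
  -- one-slot tensors are off-diagonal (no pair of distinct indices)
  have hsub1 : ∀ F : 𝓢((Fin 1 → EuclideanSpace ℝ (Fin 4)), ℂ), IsOffDiagonal F := by
    rintro F x ⟨i, j, hij, -⟩
    exact absurd (Subsingleton.elim i j) hij
  -- `K` kills the real product tensors with compactly supported pairwise disjoint factors
  have hKS : ∀ (u : Fin 3 → 𝓢(EuclideanSpace ℝ (Fin 4), ℝ)) (P : 𝓢((Fin 3 → EuclideanSpace ℝ (Fin 4)), ℂ)),
      (∀ i, HasCompactSupport (u i : EuclideanSpace ℝ (Fin 4) → ℝ)) →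
      (∀ i j, i ≠ j → Disjoint (tsupport (u i : EuclideanSpace ℝ (Fin 4) → ℝ))
        (tsupport (u j : EuclideanSpace ℝ (Fin 4) → ℝ))) →
      IsTensorOf P (fun i => ofRealTest (u i)) → K P = 0 := by
    intro u P hc hd hP
    rw [hP.unique (isTensorOf_tensorFin _)]
    simp only [hK]
    -- the sub-tuples as vector literals
    have e3 : (fun i : Fin 3 => ofRealTest (![u 0, u 1, u 2] i)) =
        ![ofRealTest (u 0), ofRealTest (u 1), ofRealTest (u 2)] := by
      funext i; fin_cases i <;> rfl
    have e3' : (fun i : Fin 3 => ofRealTest (u ((fun i : Fin 3 => i) i))) =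
        ![ofRealTest (u 0), ofRealTest (u 1), ofRealTest (u 2)] := by
      funext i; fin_cases i <;> rfl
    have e12 : (fun i : Fin 2 => ofRealTest (![u 1, u 2] i)) = ![ofRealTest (u 1), ofRealTest (u 2)] := by
      funext i; fin_cases i <;> rfl
    have e12' : (fun i : Fin 2 => ofRealTest (u (![(1 : Fin 3), 2] i))) =
        ![ofRealTest (u 1), ofRealTest (u 2)] := by
      funext i; fin_cases i <;> rfl
    have e02 : (fun i : Fin 2 => ofRealTest (![u 0, u 2] i)) = ![ofRealTest (u 0), ofRealTest (u 2)] := by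
      funext i; fin_cases i <;> rfl
    have e02' : (fun i : Fin 2 => ofRealTest (u (![(0 : Fin 3), 2] i))) =
        ![ofRealTest (u 0), ofRealTest (u 2)] := by
      funext i; fin_cases i <;> rfl
    have e01 : (fun i : Fin 2 => ofRealTest (![u 0, u 1] i)) = ![ofRealTest (u 0), ofRealTest (u 1)] := by
      funext i; fin_cases i <;> rfl
    have e01' : (fun i : Fin 2 => ofRealTest (u (![(0 : Fin 3), 1] i))) =
        ![ofRealTest (u 0), ofRealTest (u 1)] := by
      funext i; fin_cases i <;> rfl
    have e0 : (fun i : Fin 1 => ofRealTest (![u 0] i)) = ![ofRealTest (u 0)] := by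
      funext i; fin_cases i; rfl
    have e1 : (fun i : Fin 1 => ofRealTest (![u 1] i)) = ![ofRealTest (u 1)] := by
      funext i; fin_cases i; rfl
    have e2 : (fun i : Fin 1 => ofRealTest (![u 2] i)) = ![ofRealTest (u 2)] := by
      funext i; fin_cases i; rfl
    -- tensor witnesses (canonical tensors) and their off-diagonality
    have h3 : IsTensorOf (SchwartzMap.tensorFin 3 ![ofRealTest (u 0), ofRealTest (u 1), ofRealTest (u 2)])
        (fun i => ofRealTest (![u 0, u 1, u 2] i)) := by rw [e3]; exact isTensorOf_tensorFin _
    have h12 : IsTensorOf (SchwartzMap.tensorFin 2 ![ofRealTest (u 1), ofRealTest (u 2)])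
        (fun i => ofRealTest (![u 1, u 2] i)) := by rw [e12]; exact isTensorOf_tensorFin _
    have h02 : IsTensorOf (SchwartzMap.tensorFin 2 ![ofRealTest (u 0), ofRealTest (u 2)])
        (fun i => ofRealTest (![u 0, u 2] i)) := by rw [e02]; exact isTensorOf_tensorFin _
    have h01 : IsTensorOf (SchwartzMap.tensorFin 2 ![ofRealTest (u 0), ofRealTest (u 1)])
        (fun i => ofRealTest (![u 0, u 1] i)) := by rw [e01]; exact isTensorOf_tensorFin _
    have h0 : IsTensorOf (SchwartzMap.tensorFin 1 ![ofRealTest (u 0)]) (fun i => ofRealTest (![u 0] i)) := by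
      rw [e0]; exact isTensorOf_tensorFin _
    have h1 : IsTensorOf (SchwartzMap.tensorFin 1 ![ofRealTest (u 1)]) (fun i => ofRealTest (![u 1] i)) := by
      rw [e1]; exact isTensorOf_tensorFin _
    have h2 : IsTensorOf (SchwartzMap.tensorFin 1 ![ofRealTest (u 2)]) (fun i => ofRealTest (![u 2] i)) := by
      rw [e2]; exact isTensorOf_tensorFin _
    have hod3 : IsOffDiagonal
        (SchwartzMap.tensorFin 3 ![ofRealTest (u 0), ofRealTest (u 1), ofRealTest (u 2)]) :=
      isOffDiagonal_of_disjoint_tensor hd (fun i : Fin 3 => i) (fun _ _ hab => hab)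
        (by rw [e3']; exact isTensorOf_tensorFin _)
    have hod12 : IsOffDiagonal (SchwartzMap.tensorFin 2 ![ofRealTest (u 1), ofRealTest (u 2)]) :=
      isOffDiagonal_of_disjoint_tensor hd ![(1 : Fin 3), 2] (by decide)
        (by rw [e12']; exact isTensorOf_tensorFin _)
    have hod02 : IsOffDiagonal (SchwartzMap.tensorFin 2 ![ofRealTest (u 0), ofRealTest (u 2)]) :=
      isOffDiagonal_of_disjoint_tensor hd ![(0 : Fin 3), 2] (by decide)
        (by rw [e02']; exact isTensorOf_tensorFin _)
    have hod01 : IsOffDiagonal (SchwartzMap.tensorFin 2 ![ofRealTest (u 0), ofRealTest (u 1)]) :=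
      isOffDiagonal_of_disjoint_tensor hd ![(0 : Fin 3), 1] (by decide)
        (by rw [e01']; exact isTensorOf_tensorFin _)
    exact hyp (u 0) (u 1) (u 2) (hc 0) (hc 1) (hc 2) (hd 0 1 (by decide)) (hd 0 2 (by decide))
      (hd 1 2 (by decide)) _ _ _ _ _ _ _ h3 hod3 h12 hod12 h02 hod02 h01 hod01 h0 (hsub1 _) h1 (hsub1 _)
      h2 (hsub1 _)
  -- hence `K` kills `⁰𝒮`, in particular the witness tensor
  have hzero := eq_zero_offDiagonal_of_forall_disjointTensor K hKS Ffgh hoff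
  -- the witness combination is `K(f ⊗ g ⊗ h)`
  rw [hFfgh.unique (isTensorOf_tensorFin _)] at hzero
  rw [hFfgh.unique (isTensorOf_tensorFin _), hFgh.unique (isTensorOf_tensorFin _),
    hFfh.unique (isTensorOf_tensorFin _), hFfg.unique (isTensorOf_tensorFin _),
    hFf.unique (isTensorOf_tensorFin _), hFg.unique (isTensorOf_tensorFin _),
    hFh.unique (isTensorOf_tensorFin _)]
  have hKfgh := hK ![f, g, h]
  simp only [Matrix.cons_val_zero, Matrix.cons_val_one, Matrix.head_cons, Matrix.cons_val_two,
    Matrix.tail_cons] at hKfgh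
  rw [← hKfgh]
  exact hzero

end Summit.QuantumFields.YangMills.Theorems.OffDiagonalReduction

end
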